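import Mathlib.Topology.MetricSpace.Closeds
import Mathlib.Topology.MetricSpace.Thickening
import Mathlib.MeasureTheory.Constructions.BorelSpace.Basic
import Literature.Probability.RandomPlanarGeometry.CLE
import Literature.Probability.RandomPlanarGeometry.LoopSpaceMaps
import HarnessLib

/-!
# Uniform continuity of push-forwards on curve space and loop space; locally finite families

Support file for the explicit Möbius-invariant loop ensemble discharging the named fact
`Literature.Probability.RandomPlanarGeometry.exists_isCLEFamily` (`CLE.lean`). General glue on the
Aizenman–Burchard / Camia–Newman spaces `CurveClass E` (curves modulo reparametrisation) and
`LoopSpace E` (closed sets of curve classes, Hausdorff extended distance):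

* **Push-forwards.** If `f` is uniformly continuous on `K`, then `CurveClass.map f` is uniformly
  continuous on the curves with trace in `K` (`CurveClass.dist_map_map_le_of_forall`,
  `CurveClass.continuousOn_map_rangeSubset`), and `LoopSpace.map f` is continuous on the closed set
  `LoopSpace.carried K` of collections all of whose members have trace in `K`
  (`LoopSpace.continuousOn_map_carried`; globally continuous, hence Borel measurable, for a uniformly
  continuous `f`); `LoopSpace.InDomain D L` of `CLE.lean` is `L ∈ carried (closure D.carrier)`
  (`LoopSpace.inDomain_iff_mem_carried`). Consequences: functoriality `map g (map f L) = map (g ∘ f) L`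
  on such collections (`LoopSpace.map_map_of_mapsTo`), `map f (closure S) = closure (map f '' S)`
  (`LoopSpace.map_closure_eq`), and a measurable modification of `LoopSpace.map f` for an `f` that is
  only uniformly continuous on `K` (`LoopSpace.measurable_piecewise_map`).
* **Locally finite families.** `CurveClass.LocFin S` is the set form of the tree's
  `LoopSpace.IsLocallyFinite` (`CLE.lean`; `LoopSpace.isLocallyFinite_iff` is `Iff.rfl`), stated for an
  arbitrary, not necessarily closed, family `S` of curve classes: only finitely many members of
  diameter `> ε` for every `ε > 0`. Every new point of the closure of such an `S` is a trivial
  (constant) curve (`CurveClass.LocFin.isTrivial_of_mem_closure`); local finiteness passes to closures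
  and to uniformly continuous images.
* **Hitting a compact set of curves is a closed event** in loop space
  (`LoopSpace.isClosed_setOf_exists_mem_of_isCompact`).

## References

* M. Aizenman, A. Burchard, *Hölder regularity and dimension bounds for random curves*, Duke
  Math. J. 99 (1999), §2.1 (the space of curves).
* F. Camia, C. M. Newman, *Two-dimensional critical percolation: the full scaling limit*, Comm.
  Math. Phys. 268 (2006), §2 (closed collections of loops, Hausdorff distance).
-/

noncomputable section

open Set Filter Topology Metric MeasureTheory

namespace Literature.Probability.RandomPlanarGeometry

variable {E F G : Type*} [MetricSpace E] [MetricSpace F] [MetricSpace G]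

/-! ### Push-forward of curve classes along maps uniformly continuous on the traces -/

namespace CurveClass

/-- **Modulus of continuity of push-forwards.** If `dist (f x) (f y) ≤ ε` whenever `x, y ∈ K` are
`δ`-close, then two curve classes with traces in `K` at distance `< δ` have push-forwards at distance
`≤ ε`: reparametrise the second curve to be uniformly `δ`-close to the first
(Aizenman–Burchard 1999, §2.1). [folklore] -/
theorem dist_map_map_le_of_forall {f : C(E, F)} {K : Set E} {ε δ : ℝ} (hε : 0 ≤ ε)
    (hf : ∀ x ∈ K, ∀ y ∈ K, dist x y < δ → dist (f x) (f y) ≤ ε) {c c' : CurveClass E}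
    (hc : c.range ⊆ K) (hc' : c'.range ⊆ K) (h : dist c c' < δ) :
    dist (c.map f) (c'.map f) ≤ ε := by
  obtain ⟨γ, rfl⟩ := surjective_mk c
  obtain ⟨γ', rfl⟩ := surjective_mk c'
  rw [dist_mk_mk] at h
  obtain ⟨φ, hφ⟩ := Curve.exists_dist_reparam_lt h
  rw [map_mk, map_mk, dist_mk_mk, Curve.dist_def]
  refine (Curve.reparamDist_le _ _ φ).trans ?_
  rw [← Curve.map_reparam]
  refine (ContinuousMap.dist_le hε).2 fun t ↦ hf _ (hc ⟨t, rfl⟩) _ (hc' ?_) ?_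
  · rw [range_mk]
    exact ⟨φ t, rfl⟩
  · exact (ContinuousMap.dist_apply_le_dist (f := γ.toContinuousMap)
      (g := (γ'.reparam φ).toContinuousMap) t).trans_lt hφ

/-- **Push-forward along a map uniformly continuous on `K` is uniformly continuous on the curve
classes with trace in `K`** (Aizenman–Burchard 1999, §2.1). [folklore] -/
theorem uniformContinuousOn_map_rangeSubset {f : C(E, F)} {K : Set E}
    (hf : UniformContinuousOn f K) : UniformContinuousOn (map f) (rangeSubset K) := by
  rw [Metric.uniformContinuousOn_iff] at hf ⊢
  intro ε hε
  obtain ⟨δ, hδ, hfδ⟩ := hf (ε / 2) (half_pos hε)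
  refine ⟨δ, hδ, fun c hc c' hc' h ↦ ?_⟩
  have := dist_map_map_le_of_forall (half_pos hε).le (fun x hx y hy hxy ↦ (hfδ x hx y hy hxy).le)
    hc hc' h
  linarith

/-- Push-forward along a map uniformly continuous on `K` is continuous on the curve classes with
trace in `K` (Aizenman–Burchard 1999, §2.1). [folklore] -/
theorem continuousOn_map_rangeSubset {f : C(E, F)} {K : Set E} (hf : UniformContinuousOn f K) :
    ContinuousOn (map f) (rangeSubset K) :=
  (uniformContinuousOn_map_rangeSubset hf).continuousOn

/-- Push-forward along a uniformly continuous map is uniformly continuous on curve space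
(Aizenman–Burchard 1999, §2.1). [folklore] -/
theorem uniformContinuous_map {f : C(E, F)} (hf : UniformContinuous f) :
    UniformContinuous (map f) := by
  rw [← uniformContinuousOn_univ] at hf ⊢
  have h := uniformContinuousOn_map_rangeSubset hf
  rwa [show rangeSubset (univ : Set E) = univ from eq_univ_of_forall fun c ↦ subset_univ _] at h

/-- Push-forward along a uniformly continuous map is continuous on curve space
(Aizenman–Burchard 1999, §2.1). [folklore] -/
theorem continuous_map_of_uniformContinuous {f : C(E, F)} (hf : UniformContinuous f) :
    Continuous (map f) :=
  (uniformContinuous_map hf).continuous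

/-- The trace of a nearby curve class is in the closed thickening of the trace
(Aizenman–Burchard 1999, §2.1). [folklore] -/
theorem range_subset_cthickening (c c' : CurveClass E) :
    c.range ⊆ cthickening (dist c c') c'.range := by
  obtain ⟨γ, rfl⟩ := surjective_mk c
  obtain ⟨γ', rfl⟩ := surjective_mk c'
  rintro _ ⟨t, rfl⟩
  obtain ⟨y, hy, hdist⟩ := γ'.isCompact_range.exists_infDist_eq_dist γ'.range_nonempty (γ t)
  refine mem_cthickening_of_dist_le _ y _ _ hy ?_
  rw [← hdist]
  exact Curve.infDist_range_le γ γ' t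

/-- The diameter of the trace is `2`-Lipschitz-controlled by the curve distance:
`diam c.range ≤ diam c'.range + 2 dist c c'` (Aizenman–Burchard 1999, §2.1). [folklore] -/
theorem diam_range_le (c c' : CurveClass E) :
    diam c.range ≤ diam c'.range + 2 * dist c c' :=
  (diam_mono (range_subset_cthickening c c') (isCompact_range c').isBounded.cthickening).trans
    (diam_cthickening_le _ dist_nonneg)

/-- A curve class whose trace has diameter zero is trivial. [folklore] -/
theorem isTrivial_of_diam_eq_zero {c : CurveClass E} (h : diam c.range = 0) : c.IsTrivial := by
  have hb : ediam c.range ≠ ⊤ := (isCompact_range c).isBounded.ediam_ne_top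
  rw [Metric.diam, ENNReal.toReal_eq_zero_iff] at h
  exact ediam_eq_zero_iff.1 (h.resolve_right hb)

/-! ### Locally finite families of curve classes -/

/-- A family of curve classes is *locally finite* if for every `ε > 0` only finitely many of its
members have trace of diameter `> ε` (Camia–Newman 2006, §2; Sheffield 2009, §1.1). This is the set
form of `LoopSpace.IsLocallyFinite` (`CLE.lean`), which is the case of the (closed) family underlying a
point of `LoopSpace E` (`LoopSpace.isLocallyFinite_iff`). [folklore] -/
def LocFin (S : Set (CurveClass E)) : Prop :=
  ∀ ε : ℝ, 0 < ε → {c ∈ S | ε < diam c.range}.Finite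

namespace LocFin

variable {S : Set (CurveClass E)}

/-- Local finiteness is inherited by subfamilies. [folklore] -/
theorem mono {T : Set (CurveClass E)} (h : LocFin S) (hT : T ⊆ S) : LocFin T :=
  fun ε hε ↦ (h ε hε).subset fun _ hc ↦ ⟨hT hc.1, hc.2⟩

/-- **A new point of the closure of a locally finite family is a trivial curve**: along a sequence of
members converging to it, all but finitely many members have small diameter (a member occurring
infinitely often would be the limit itself), and the diameter of the trace is continuous up to twice
the curve distance (Camia–Newman 2006, §2). [folklore] -/
theorem isTrivial_of_mem_closure (h : LocFin S) {c : CurveClass E} (hc : c ∈ closure S)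
    (hcS : c ∉ S) : c.IsTrivial := by
  obtain ⟨u, huS, hu⟩ := mem_closure_iff_seq_limit.1 hc
  refine isTrivial_of_diam_eq_zero (le_antisymm (le_of_forall_pos_le_add fun ε hε ↦ ?_) diam_nonneg)
  rw [zero_add]
  -- eventually `u n` is not one of the finitely many members of diameter `> ε / 3`
  have hev : ∀ᶠ n in atTop, u n ∉ {c' ∈ S | ε / 3 < diam c'.range} := by
    have hfin := h (ε / 3) (by positivity)
    have key : ∀ c' ∈ {c' ∈ S | ε / 3 < diam c'.range}, ∀ᶠ n in atTop, u n ≠ c' := by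
      intro c' hc'
      by_contra hne
      rw [not_eventually] at hne
      simp only [ne_eq, not_not] at hne
      have : c = c' := tendsto_nhds_unique_of_frequently_eq hu tendsto_const_nhds hne
      exact hcS (this ▸ hc'.1)
    filter_upwards [hfin.eventually_all.2 key] with n hn hmem
    exact hn _ hmem rfl
  have hev' : ∀ᶠ n in atTop, dist (u n) c < ε / 3 :=
    (tendsto_iff_dist_tendsto_zero.1 hu).eventually (gt_mem_nhds (by positivity))
  obtain ⟨n, hn, hn'⟩ := (hev.and hev').exists
  have hdiam : diam (u n).range ≤ ε / 3 := by
    by_contra hlt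
    exact hn ⟨huS n, not_le.1 hlt⟩
  have := diam_range_le c (u n)
  rw [dist_comm] at this
  linarith

/-- The members of the closure of a locally finite family are members or trivial curves
(Camia–Newman 2006, §2). [folklore] -/
theorem mem_or_isTrivial_of_mem_closure (h : LocFin S) {c : CurveClass E} (hc : c ∈ closure S) :
    c ∈ S ∨ c.IsTrivial :=
  (em (c ∈ S)).imp_right (h.isTrivial_of_mem_closure hc)

/-- The non-trivial members of the closure of a locally finite family are members. [folklore] -/
theorem mem_of_mem_closure_of_not_isTrivial (h : LocFin S) {c : CurveClass E} (hc : c ∈ closure S)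
    (hnt : ¬ c.IsTrivial) : c ∈ S :=
  (h.mem_or_isTrivial_of_mem_closure hc).resolve_right hnt

/-- The closure of a locally finite family is locally finite (new points are trivial, of diameter
zero). [folklore] -/
theorem closure (h : LocFin S) : LocFin (closure S) := by
  intro ε hε
  refine (h ε hε).subset fun c ⟨hc, hcε⟩ ↦ ⟨?_, hcε⟩
  refine h.mem_of_mem_closure_of_not_isTrivial hc fun htriv ↦ ?_
  have : diam c.range = 0 := Metric.diam_subsingleton htriv
  linarith

/-- A uniformly continuous (on the traces) image of a locally finite family is locally finite.
[folklore] -/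
theorem image {f : C(E, F)} {K : Set E} (h : LocFin S) (hK : ∀ c ∈ S, c.range ⊆ K)
    (hf : UniformContinuousOn f K) : LocFin (map f '' S) := by
  intro ε hε
  obtain ⟨δ, hδ, hfδ⟩ := Metric.uniformContinuousOn_iff.1 hf (ε / 2) (half_pos hε)
  have hfin := (h (δ / 2) (half_pos hδ)).image (map f)
  refine hfin.subset ?_
  rintro _ ⟨⟨c, hcS, rfl⟩, hcε⟩
  refine ⟨c, ⟨hcS, ?_⟩, rfl⟩
  -- if `diam c.range ≤ δ / 2 < δ` then `diam (f '' c.range) ≤ ε / 2`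
  by_contra hle
  rw [not_lt] at hle
  have hdiam : diam (c.map f).range ≤ ε / 2 := by
    rw [range_map]
    refine diam_le_of_forall_dist_le (half_pos hε).le ?_
    rintro _ ⟨x, hx, rfl⟩ _ ⟨y, hy, rfl⟩
    refine (hfδ x (hK c hcS hx) y (hK c hcS hy) ?_).le
    calc dist x y ≤ diam c.range := dist_le_diam_of_mem (isCompact_range c).isBounded hx hy
      _ ≤ δ / 2 := hle
      _ < δ := half_lt_self hδ
  exact absurd (hcε.trans_le hdiam) (by linarith)

end LocFin

/-- A family of loops has closure consisting of loops (the set of loops is closed,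
`isClosed_setOf_isLoop`; Camia–Newman 2006, §2). [folklore] -/
theorem isLoop_of_mem_closure {S : Set (CurveClass E)} (hS : ∀ c ∈ S, c.IsLoop) {c : CurveClass E}
    (hc : c ∈ closure S) : c.IsLoop :=
  closure_minimal (fun c hc ↦ (hS c hc : c ∈ {c : CurveClass E | c.IsLoop})) isClosed_setOf_isLoop hc

/-- A family of curves with traces in a closed set `K` has closure with traces in `K`
(`isClosed_rangeSubset`). [folklore] -/
theorem range_subset_of_mem_closure {S : Set (CurveClass E)} {K : Set E} (hK : IsClosed K)
    (hS : ∀ c ∈ S, c.range ⊆ K) {c : CurveClass E} (hc : c ∈ closure S) : c.range ⊆ K :=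
  closure_minimal (fun c hc ↦ (hS c hc : c ∈ rangeSubset K)) (isClosed_rangeSubset hK) hc

end CurveClass

/-! ### Loop collections carried by a set; continuity of push-forwards of collections -/

namespace LoopSpace

variable {K : Set E}

/-- The loop collections *carried by* `K`: all members have trace in `K`
(Camia–Newman 2006, §2: collections of loops in a closed domain). [folklore] -/
def carried (K : Set E) : Set (LoopSpace E) :=
  {L | (L : Set (CurveClass E)) ⊆ CurveClass.rangeSubset K}

/-- Membership in `carried K`. [folklore] -/
theorem mem_carried_iff {L : LoopSpace E} : L ∈ carried K ↔ ∀ c ∈ L, CurveClass.range c ⊆ K :=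
  Iff.rfl

/-- `carried` is monotone. [folklore] -/
theorem carried_mono {K K' : Set E} (h : K ⊆ K') : carried K ⊆ carried K' :=
  fun _ hL _ hc ↦ (hL hc).trans h

/-- `LoopSpace.IsLocallyFinite` (`CLE.lean`) is local finiteness of the underlying family. [folklore] -/
theorem isLocallyFinite_iff (L : LoopSpace E) :
    L.IsLocallyFinite ↔ CurveClass.LocFin (L : Set (CurveClass E)) := Iff.rfl

/-- `LoopSpace.InDomain D L` (`CLE.lean`) says that `L` is carried by `closure D`. [folklore] -/
theorem inDomain_iff_mem_carried (D : JordanDomain) (L : LoopSpace ℂ) :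
    LoopSpace.InDomain D L ↔ L ∈ carried (closure D.carrier) := Iff.rfl

/-- For closed `K` the collections carried by `K` form a closed set of loop space (closed sets of
curve classes contained in the closed set `rangeSubset K`). [folklore] -/
theorem isClosed_carried (hK : IsClosed K) : IsClosed (carried K) :=
  TopologicalSpace.Closeds.isClosed_subsets_of_isClosed (CurveClass.isClosed_rangeSubset hK)

/-- For closed `K` the collections carried by `K` form a Borel set. [folklore] -/
theorem measurableSet_carried (hK : IsClosed K) : MeasurableSet (carried K) :=
  (isClosed_carried hK).measurableSet

/-- The underlying set of a push-forward is the closure of the image (`LoopSpace.coe_induced` of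
`LoopSpaceMaps.lean` through `map_eq_induced`). [folklore] -/
theorem coe_map (f : C(E, F)) (L : LoopSpace E) :
    (map f L : Set (CurveClass F)) = closure (CurveClass.map f '' (L : Set (CurveClass E))) :=
  coe_induced _ _

/-- A push-forward along a map taking all traces into a closed set `K'` is carried by `K'`. [folklore] -/
theorem map_mem_carried {f : C(E, F)} {K' : Set F} (hK' : IsClosed K') {L : LoopSpace E}
    (h : ∀ c ∈ L, MapsTo f (CurveClass.range c) K') : map f L ∈ carried K' := by
  intro c hc
  rw [coe_map] at hc
  refine CurveClass.range_subset_of_mem_closure hK' ?_ hc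
  rintro _ ⟨c', hc', rfl⟩
  rw [CurveClass.range_map]
  exact (h c' hc').image_subset

/-- A push-forward along a map with values in a closed set `K'` is carried by `K'`. [folklore] -/
theorem map_mem_carried_of_range_subset {f : C(E, F)} {K' : Set F} (hK' : IsClosed K')
    (hf : Set.range f ⊆ K') (L : LoopSpace E) : map f L ∈ carried K' :=
  map_mem_carried hK' fun _ _ _ _ ↦ hf (mem_range_self _)

/-- **Hausdorff modulus of continuity of push-forwards of collections.** If `dist (f x) (f y) ≤ ε`
for `δ`-close `x, y ∈ K`, then two collections carried by `K` at Hausdorff edistance `< δ` have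
push-forwards at Hausdorff edistance `≤ ε` (Camia–Newman 2006, §2). [folklore] -/
theorem edist_map_map_le_of_forall {f : C(E, F)} {ε δ : ℝ} (hε : 0 ≤ ε)
    (hf : ∀ x ∈ K, ∀ y ∈ K, dist x y < δ → dist (f x) (f y) ≤ ε) {L L' : LoopSpace E}
    (hL : L ∈ carried K) (hL' : L' ∈ carried K) (h : edist L L' < ENNReal.ofReal δ) :
    edist (map f L) (map f L') ≤ ENNReal.ofReal ε := by
  rw [TopologicalSpace.Closeds.edist_eq] at h ⊢
  rw [coe_map, coe_map, hausdorffEDist_closure]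
  have key : ∀ {L L' : LoopSpace E}, L ∈ carried K → L' ∈ carried K →
      hausdorffEDist (L : Set (CurveClass E)) L' < ENNReal.ofReal δ →
      ∀ x ∈ CurveClass.map f '' (L : Set (CurveClass E)),
        ∃ y ∈ CurveClass.map f '' (L' : Set (CurveClass E)), edist x y ≤ ENNReal.ofReal ε := by
    intro L L' hL hL' h
    rintro _ ⟨c, hc, rfl⟩
    obtain ⟨c', hc', hcc'⟩ := exists_edist_lt_of_hausdorffEDist_lt hc h
    refine ⟨_, ⟨c', hc', rfl⟩, ?_⟩
    rw [edist_lt_ofReal] at hcc'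
    rw [edist_dist]
    exact ENNReal.ofReal_le_ofReal (CurveClass.dist_map_map_le_of_forall hε hf (hL hc) (hL' hc') hcc')
  refine hausdorffEDist_le_of_mem_edist (key hL hL' h) (key hL' hL ?_)
  rwa [hausdorffEDist_comm]

/-- **Push-forward of collections along a map uniformly continuous on `K` is continuous on the
collections carried by `K`** (Camia–Newman 2006, §2). [folklore] -/
theorem continuousOn_map_carried {f : C(E, F)} (hf : UniformContinuousOn f K) :
    ContinuousOn (map f) (carried K) := by
  rw [EMetric.continuousOn_iff]
  intro L hL ε hε
  obtain ⟨ε', hε'0, hε'⟩ : ∃ ε' : ℝ, 0 < ε' ∧ ENNReal.ofReal ε' < ε := by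
    rcases eq_or_ne ε ⊤ with rfl | hne
    · exact ⟨1, one_pos, ENNReal.ofReal_lt_top⟩
    · refine ⟨ε.toReal / 2, by positivity [ENNReal.toReal_pos hε.ne' hne], ?_⟩
      rw [← ENNReal.ofReal_toReal hne]
      exact (ENNReal.ofReal_lt_ofReal_iff (ENNReal.toReal_pos hε.ne' hne)).2
        (by rw [ENNReal.toReal_ofReal ENNReal.toReal_nonneg]; linarith [ENNReal.toReal_pos hε.ne' hne])
  obtain ⟨δ, hδ, hfδ⟩ := Metric.uniformContinuousOn_iff.1 hf (ε' / 2) (half_pos hε'0)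
  refine ⟨ENNReal.ofReal δ, ENNReal.ofReal_pos.2 hδ, fun L' hL' hLL' ↦ ?_⟩
  have := edist_map_map_le_of_forall (half_pos hε'0).le (fun x hx y hy hxy ↦ (hfδ x hx y hy hxy).le)
    hL' hL hLL'
  refine this.trans_lt ((ENNReal.ofReal_lt_ofReal_iff hε'0).2 (half_lt_self hε'0)) |>.trans hε'

/-- Push-forward of collections along a uniformly continuous map is continuous on loop space
(Camia–Newman 2006, §2). [folklore] -/
theorem continuous_map_of_uniformContinuous {f : C(E, F)} (hf : UniformContinuous f) :
    Continuous (map f) := by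
  rw [← continuousOn_univ]
  rw [← uniformContinuousOn_univ] at hf
  have h := continuousOn_map_carried hf
  rwa [show carried (univ : Set E) = univ from eq_univ_of_forall fun L c _ ↦ subset_univ _] at h

/-- Push-forward of collections along a uniformly continuous map is Borel measurable. [folklore] -/
theorem measurable_map_of_uniformContinuous {f : C(E, F)} (hf : UniformContinuous f) :
    Measurable (map f) :=
  (continuous_map_of_uniformContinuous hf).measurable

/-- Images of closures: `map f '' closure A ⊆ closure (map f '' A)` for a family `A` of curves with
traces in a closed set `K` on which `f` is uniformly continuous. [folklore] -/
theorem image_closure_subset_closure_image {f : C(E, F)} (hK : IsClosed K)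
    (hf : UniformContinuousOn f K) {A : Set (CurveClass E)} (hA : A ⊆ CurveClass.rangeSubset K) :
    CurveClass.map f '' closure A ⊆ closure (CurveClass.map f '' A) := by
  rintro _ ⟨c, hc, rfl⟩
  have hcK : c ∈ CurveClass.rangeSubset K :=
    closure_minimal hA (CurveClass.isClosed_rangeSubset hK) hc
  exact (((CurveClass.continuousOn_map_rangeSubset hf) c hcK).mono hA).mem_closure_image hc

/-- `closure (map f '' closure A) = closure (map f '' A)` under the same hypotheses. [folklore] -/
theorem closure_image_closure {f : C(E, F)} (hK : IsClosed K) (hf : UniformContinuousOn f K)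
    {A : Set (CurveClass E)} (hA : A ⊆ CurveClass.rangeSubset K) :
    closure (CurveClass.map f '' closure A) = closure (CurveClass.map f '' A) :=
  (closure_minimal (image_closure_subset_closure_image hK hf hA) isClosed_closure).antisymm
    (closure_mono (image_mono subset_closure))

/-- **Push-forward of the closure of a family**: `map f (closure A) = closure (map f '' A)` for a
family `A` of curves with traces in a closed set on which `f` is uniformly continuous. [folklore] -/
theorem map_closure_eq {f : C(E, F)} (hK : IsClosed K) (hf : UniformContinuousOn f K)
    {A : Set (CurveClass E)} (hA : A ⊆ CurveClass.rangeSubset K) :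
    map f (TopologicalSpace.Closeds.closure A) =
      TopologicalSpace.Closeds.closure (CurveClass.map f '' A) := by
  apply TopologicalSpace.Closeds.ext
  rw [coe_map, TopologicalSpace.Closeds.coe_closure, TopologicalSpace.Closeds.coe_closure]
  exact closure_image_closure hK hf hA

/-- Push-forward of the closure of a family along a uniformly continuous map. [folklore] -/
theorem map_closure_eq_of_uniformContinuous {f : C(E, F)} (hf : UniformContinuous f)
    (A : Set (CurveClass E)) :
    map f (TopologicalSpace.Closeds.closure A) =
      TopologicalSpace.Closeds.closure (CurveClass.map f '' A) := by
  rw [← uniformContinuousOn_univ] at hf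
  exact map_closure_eq isClosed_univ hf fun _ _ ↦ subset_univ _

/-- **Functoriality of push-forwards of collections**: `map g (map f L) = map (g ∘ f) L` when `f`
takes the traces of the members of `L` into a closed set on which `g` is uniformly continuous
(Camia–Newman 2006, §2). [folklore] -/
theorem map_map_of_mapsTo {f : C(E, F)} {g : C(F, G)} {K' : Set F} (hK' : IsClosed K')
    (hg : UniformContinuousOn g K') {L : LoopSpace E}
    (hL : ∀ c ∈ L, MapsTo f (CurveClass.range c) K') : map g (map f L) = map (g.comp f) L := by
  have hA : CurveClass.map f '' (L : Set (CurveClass E)) ⊆ CurveClass.rangeSubset K' := by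
    rintro _ ⟨c, hc, rfl⟩
    rw [CurveClass.mem_rangeSubset, CurveClass.range_map]
    exact (hL c hc).image_subset
  change map g (TopologicalSpace.Closeds.closure _) = _
  rw [map_closure_eq hK' hg hA, image_image]
  simp only [CurveClass.map_map]
  rfl

/-- Functoriality of push-forwards of collections for a uniformly continuous outer map
(`LoopSpace.induced_induced` of `LoopSpaceMaps.lean` plus `CurveClass.map_map`). [folklore] -/
theorem map_map_of_uniformContinuous {g : C(F, G)} (hg : UniformContinuous g) (f : C(E, F))
    (L : LoopSpace E) : map g (map f L) = map (g.comp f) L := by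
  rw [map_eq_induced, map_eq_induced, map_eq_induced,
    induced_induced (CurveClass.continuous_map_of_uniformContinuous hg)]
  congr 1
  exact funext fun c ↦ CurveClass.map_map f g c

/-- Two maps agreeing on `K` have the same push-forward on collections carried by `K`. [folklore] -/
theorem map_congr_of_carried {f f' : C(E, F)} {L : LoopSpace E} (hL : L ∈ carried K)
    (h : EqOn f f' K) : map f L = map f' L := by
  apply TopologicalSpace.Closeds.ext
  rw [coe_map, coe_map]
  congr 1
  refine image_congr fun c hc ↦ ?_
  obtain ⟨γ, rfl⟩ := CurveClass.surjective_mk c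
  rw [CurveClass.map_mk, CurveClass.map_mk]
  congr 1
  ext t
  exact h (hL hc ⟨t, rfl⟩)

/-- A measurable modification of the push-forward along a map that is only uniformly continuous
on a closed set `K`: `map f` on the collections carried by `K`, the empty collection elsewhere. [folklore] -/
theorem measurable_piecewise_map {f : C(E, F)} (hK : IsClosed K) (hf : UniformContinuousOn f K)
    [DecidablePred (· ∈ carried K)] :
    Measurable ((carried K).piecewise (map f) fun _ ↦ (⊥ : LoopSpace F)) :=
  (continuousOn_map_carried hf).measurable_piecewise continuousOn_const (measurableSet_carried hK)

/-- The push-forward along a map uniformly continuous on a closed set `K` is a.e.-measurable for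
every law carried by `K`. [folklore] -/
theorem aemeasurable_map_of_ae_mem_carried {f : C(E, F)} (hK : IsClosed K)
    (hf : UniformContinuousOn f K) {μ : Measure (LoopSpace E)} (hμ : ∀ᵐ L ∂μ, L ∈ carried K) :
    AEMeasurable (map f) μ := by
  classical
  refine ⟨(carried K).piecewise (map f) fun _ ↦ (⊥ : LoopSpace F), measurable_piecewise_map hK hf, ?_⟩
  filter_upwards [hμ] with L hL
  rw [piecewise_eq_of_mem _ _ _ hL]

/-! ### Hitting a compact set of curves -/

/-- **Hitting a compact set of curve classes is a closed event in loop space**: if `L` misses the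
compact set `C`, then `C` and the closed set `L` are at positive edistance, and every collection
Hausdorff-close to `L` still misses `C` (Camia–Newman 2006, §2). [folklore] -/
theorem isClosed_setOf_exists_mem_of_isCompact {C : Set (CurveClass E)} (hC : IsCompact C) :
    IsClosed {L : LoopSpace E | ∃ c ∈ C, c ∈ L} := by
  rw [← isOpen_compl_iff, EMetric.isOpen_iff]
  intro L hL
  simp only [mem_compl_iff, mem_setOf_eq, not_exists, not_and] at hL
  have hdisj : Disjoint C (L : Set (CurveClass E)) := disjoint_left.2 fun c hc hcL ↦ hL c hc hcL
  obtain ⟨r, hr, hr'⟩ := exists_pos_forall_lt_edist hC L.isClosed hdisj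
  refine ⟨r, by exact_mod_cast hr, fun L' hL' ↦ ?_⟩
  simp only [mem_compl_iff, mem_setOf_eq, not_exists, not_and]
  intro c hc hcL'
  rw [Metric.mem_eball, TopologicalSpace.Closeds.edist_eq] at hL'
  have h1 : infEDist c (L : Set (CurveClass E)) < r :=
    (infEDist_le_hausdorffEDist_of_mem hcL').trans_lt hL'
  have h2 : (r : ENNReal) ≤ infEDist c (L : Set (CurveClass E)) :=
    le_infEDist.2 fun y hy ↦ (hr' c hc y hy).le
  exact absurd (h2.trans_lt h1) (lt_irrefl _)

/-- Containing a given curve class is a closed event in loop space. [folklore] -/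
theorem isClosed_setOf_mem (c : CurveClass E) : IsClosed {L : LoopSpace E | c ∈ L} := by
  have h := isClosed_setOf_exists_mem_of_isCompact (isCompact_singleton (x := c))
  convert h using 2
  simp

end LoopSpace

end Literature.Probability.RandomPlanarGeometry
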